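import Literature.RingTheory.FormalGroups.FormalGroupHom
import HarnessLib

/-!
# Sums of homomorphisms into a commutative formal group law; the endomorphism semiring data; `[n]`-series
# ([Hazewinkel 1978] §1.2, (1.2.4)–(1.2.6); [Silverman 2009] Ch. IV §2; [Lubin–Tate 1965] §1)

Topic `Literature/RingTheory/FormalGroups`; namespace `Literature.RingTheory.FormalGroups`.  DEFINITIONS + fully proved
theorems; no named fact, no instance, no notation, no `sorry`.  Cell `hodgecm-mathlib`, P6 «MOD programme» ROW 4B,
base layer of letter L4B.3 (formal `𝒪`-modules ∕ Lubin–Tate), second file after `FormalGroupHom`.  Carrier: Mathlib's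
`FormalGroup R` with its `IsComm`, `assoc'`, `comm'`, `add_zero`, `zero_add`.

## Contents

* `FormalGroup`-level INTERCHANGE LAW for a commutative law: `G(G(a,b), G(c,d)) = G(G(a,c), G(b,d))`
  (`subst_pair_interchange`), and `powerSeries_subst_formalGroup_pair : (G(f,g))(a) = G(f(a), g(a))`.
* `FormalGroupHom.add φ ψ` for `[G.IsComm]`: the series `G(φ(T), ψ(T))` IS a homomorphism `F → G`
  ([Hazewinkel1978] §1.2 (1.2.5): `Hom_R(F,G)` is an abelian group under `φ + ψ := G(φ, ψ)`); `add_comm`, `add_assoc`,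
  `zero_add`, `add_zero` (named theorems — no instance is declared in this statement∕definition file).
* BOTH DISTRIBUTIVE LAWS: `comp_add : χ ∘ (φ + ψ) = χ∘φ + χ∘ψ` (uses that `χ` is a homomorphism) and
  `add_comp : (φ + ψ) ∘ χ = φ∘χ + ψ∘χ` (substitution only) — with `comp_assoc`, `id_comp`, `comp_id`, `zero_comp`,
  `comp_zero` of `FormalGroupHom` this is the (semi)ring data of `End_R(F)` ([Hazewinkel1978] §1.2 (1.2.6)).
* the `[n]`-SERIES `nsmulHom F n : FormalGroupHom F F` (`[0] = 0`, `[n+1](T) = F([n](T), T)`), and the linear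
  coefficients: `coeff_one_add : ([φ + ψ])₁ = φ₁ + ψ₁`, `coeff_one_nsmulHom : [n](T) ≡ n·T (mod deg 2)`
  ([Hazewinkel1978] §1.2 (1.2.4); [SilvermanAEC2009] IV Prop. 2.3).

Deliberately NOT here: negatives ∕ the inverse series `ι` (so `Hom_R(F,G)` is only shown to be a commutative MONOID),
heights, formal `𝒪`-modules, Lubin–Tate series.
-/

noncomputable section

namespace Literature.RingTheory.FormalGroups

open _root_.MvPowerSeries (HasSubst subst)

universe u

variable {R : Type u} [CommRing R]

/-! ## §0 Two substitution identities for a formal group law -/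

/-- `(G(f,g))(a) = G(f(a), g(a))` for univariate `f`, `g` and substitutable `a`: substituting INTO a value of the law.
[cite: BourbakiAlgebraII2003, Ch. IV §4 no. 3] -/
theorem powerSeries_subst_formalGroup_pair (G : FormalGroup R) {f g : PowerSeries R}
    (hf : PowerSeries.HasSubst f) (hg : PowerSeries.HasSubst g) {τ : Type*} {a : MvPowerSeries τ R}
    (ha : PowerSeries.HasSubst a) :
    PowerSeries.subst a (G.toPowerSeries.subst ![f, g]) =
      G.toPowerSeries.subst ![PowerSeries.subst a f, PowerSeries.subst a g] := by
  rw [PowerSeries.subst_def, MvPowerSeries.subst_comp_subst_apply (hasSubst_pair hf hg) ha.const]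
  congr 1
  funext s; fin_cases s <;> rfl

/-- **Interchange law** for a commutative formal group law: `G(G(a,b), G(c,d)) = G(G(a,c), G(b,d))` for all
substitutable `a b c d` (associativity twice, commutativity once, associativity twice).
[cite: Hazewinkel1978, §1.2 (1.2.5)] -/
theorem subst_pair_interchange (G : FormalGroup R) [G.IsComm] {τ : Type*} {a b c d : MvPowerSeries τ R}
    (ha : PowerSeries.HasSubst a) (hb : PowerSeries.HasSubst b) (hc : PowerSeries.HasSubst c)
    (hd : PowerSeries.HasSubst d) :
    G.toPowerSeries.subst ![G.toPowerSeries.subst ![a, b], G.toPowerSeries.subst ![c, d]] =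
      G.toPowerSeries.subst ![G.toPowerSeries.subst ![a, c], G.toPowerSeries.subst ![b, d]] := by
  rw [G.assoc' ha hb (hasSubst_formalGroup_subst G hc hd), ← G.assoc' hb hc hd, G.comm' hb hc, G.assoc' hc hb hd,
    ← G.assoc' ha hc (hasSubst_formalGroup_subst G hb hd)]

namespace FormalGroupHom

variable {F G H : FormalGroup R}

/-! ## §1 The sum of two homomorphisms into a commutative law -/

/-- **Sum of homomorphisms** into a commutative formal group law: `(φ + ψ)(T) := G(φ(T), ψ(T))`; it IS a homomorphism
`F → G`: `(φ+ψ)(F(X,Y)) = G(G(φX,φY), G(ψX,ψY)) = G(G(φX,ψX), G(φY,ψY))` by the interchange law.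
[cite: Hazewinkel1978, §1.2 (1.2.5)] -/
def add [G.IsComm] (φ ψ : FormalGroupHom F G) : FormalGroupHom F G where
  toPowerSeries := G.toPowerSeries.subst ![φ.toPowerSeries, ψ.toPowerSeries]
  constantCoeff_eq_zero :=
    MvPowerSeries.constantCoeff_subst_eq_zero (hasSubst_pair φ.hasSubst ψ.hasSubst)
      (fun i => by fin_cases i; exacts [φ.constantCoeff_eq_zero, ψ.constantCoeff_eq_zero]) G.zero_constantCoeff
  map_add := by
    have h0 : PowerSeries.HasSubst (MvPowerSeries.X 0 : MvPowerSeries (Fin 2) R) := PowerSeries.HasSubst.X 0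
    have h1 : PowerSeries.HasSubst (MvPowerSeries.X 1 : MvPowerSeries (Fin 2) R) := PowerSeries.HasSubst.X 1
    rw [powerSeries_subst_formalGroup_pair G φ.hasSubst ψ.hasSubst (hasSubst_formalGroup F), φ.map_add, ψ.map_add,
      subst_pair_interchange G (φ.hasSubst_subst h0) (φ.hasSubst_subst h1) (ψ.hasSubst_subst h0) (ψ.hasSubst_subst h1),
      powerSeries_subst_formalGroup_pair G φ.hasSubst ψ.hasSubst h0,
      powerSeries_subst_formalGroup_pair G φ.hasSubst ψ.hasSubst h1]

/-- The series of `φ + ψ` is `G(φ(T), ψ(T))`. [cite: Hazewinkel1978, §1.2 (1.2.5)] -/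
@[simp] theorem add_toPowerSeries [G.IsComm] (φ ψ : FormalGroupHom F G) :
    (φ.add ψ).toPowerSeries = G.toPowerSeries.subst ![φ.toPowerSeries, ψ.toPowerSeries] := rfl

/-- `φ + ψ = ψ + φ`. [cite: Hazewinkel1978, §1.2 (1.2.5)] -/
theorem add_comm [G.IsComm] (φ ψ : FormalGroupHom F G) : φ.add ψ = ψ.add φ := by
  ext1; simp only [add_toPowerSeries]; exact G.comm' φ.hasSubst ψ.hasSubst

/-- `(φ + ψ) + χ = φ + (ψ + χ)`. [cite: Hazewinkel1978, §1.2 (1.2.5)] -/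
theorem add_assoc [G.IsComm] (φ ψ χ : FormalGroupHom F G) : (φ.add ψ).add χ = φ.add (ψ.add χ) := by
  ext1; simp only [add_toPowerSeries]; exact G.assoc' φ.hasSubst ψ.hasSubst χ.hasSubst

/-- `0 + φ = φ`. [cite: Hazewinkel1978, §1.2 (1.2.5)] -/
theorem zero_add [G.IsComm] (φ : FormalGroupHom F G) : (FormalGroupHom.zero F G).add φ = φ := by
  ext1; simp only [add_toPowerSeries, zero_toPowerSeries]; exact G.zero_add φ.hasSubst

/-- `φ + 0 = φ`. [cite: Hazewinkel1978, §1.2 (1.2.5)] -/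
theorem add_zero [G.IsComm] (φ : FormalGroupHom F G) : φ.add (FormalGroupHom.zero F G) = φ := by
  ext1; simp only [add_toPowerSeries, zero_toPowerSeries]; exact G.add_zero φ.hasSubst

/-! ## §2 The distributive laws (composition is bi-additive) -/

/-- **Left distributivity** `χ ∘ (φ + ψ) = χ ∘ φ + χ ∘ ψ` — this is `χ(G(φ,ψ)) = H(χφ, χψ)`, i.e. exactly that `χ` is
a homomorphism (`map_add'`). [cite: Hazewinkel1978, §1.2 (1.2.6)] -/
theorem comp_add [G.IsComm] [H.IsComm] (χ : FormalGroupHom G H) (φ ψ : FormalGroupHom F G) :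
    χ.comp (φ.add ψ) = (χ.comp φ).add (χ.comp ψ) := by
  ext1
  simp only [comp_toPowerSeries, add_toPowerSeries]
  exact χ.map_add' φ.hasSubst ψ.hasSubst

/-- **Right distributivity** `(φ + ψ) ∘ χ = φ ∘ χ + ψ ∘ χ` — pure substitution: `(H(φ,ψ))(χ) = H(φ(χ), ψ(χ))`.
[cite: Hazewinkel1978, §1.2 (1.2.6)] -/
theorem add_comp [H.IsComm] (φ ψ : FormalGroupHom G H) (χ : FormalGroupHom F G) :
    (φ.add ψ).comp χ = (φ.comp χ).add (ψ.comp χ) := by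
  ext1
  simp only [comp_toPowerSeries, add_toPowerSeries]
  exact powerSeries_subst_formalGroup_pair H φ.hasSubst ψ.hasSubst χ.hasSubst

/-! ## §3 Linear coefficients -/

/-- The linear coefficient of `G(f,g)` is `f₁ + g₁` for univariate `f`, `g` without constant term (`G ≡ X + Y` modulo
degree `2`). [cite: Hazewinkel1978, §1.1 Def. (1.1.1)] -/
theorem coeff_one_formalGroup_subst_pair (G : FormalGroup R) {f g : PowerSeries R}
    (hf : PowerSeries.constantCoeff f = 0) (hg : PowerSeries.constantCoeff g = 0) :
    PowerSeries.coeff 1 (G.toPowerSeries.subst ![f, g]) = PowerSeries.coeff 1 f + PowerSeries.coeff 1 g := by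
  classical
  have hfg : HasSubst ![f, g] := hasSubst_pair (PowerSeries.HasSubst.of_constantCoeff_zero' hf)
    (PowerSeries.HasSubst.of_constantCoeff_zero' hg)
  obtain ⟨f', rfl⟩ : PowerSeries.X ∣ f := (PowerSeries.X_dvd_iff).mpr hf
  obtain ⟨g', rfl⟩ : PowerSeries.X ∣ g := (PowerSeries.X_dvd_iff).mpr hg
  -- the term of the substitution formula at the exponent `d`
  have hterm : ∀ d : Fin 2 →₀ ℕ, d ≠ Finsupp.single 0 1 → d ≠ Finsupp.single 1 1 →
      MvPowerSeries.coeff d G.toPowerSeries •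
        PowerSeries.coeff 1 (d.prod fun s e => ((![PowerSeries.X * f', PowerSeries.X * g'] :
          Fin 2 → PowerSeries R) s) ^ e) = 0 := by
    intro d hd0 hd1
    rw [Finsupp.prod_fintype _ _ (fun _ => pow_zero _)]
    simp only [Fin.prod_univ_two, Matrix.cons_val_zero, Matrix.cons_val_one]
    by_cases hd : d = 0
    · subst hd
      have : MvPowerSeries.coeff (0 : Fin 2 →₀ ℕ) G.toPowerSeries = 0 := by
        simpa using G.zero_constantCoeff
      rw [this, zero_smul]
    · -- `d 0 + d 1 ≥ 2`, so the product is divisible by `X ^ 2`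
      have h2 : 2 ≤ d 0 + d 1 := by
        by_contra hlt
        have hle : d 0 + d 1 ≤ 1 := by omega
        rcases Nat.le_one_iff_eq_zero_or_eq_one.mp hle with h | h
        · exact hd (by ext i; fin_cases i <;> simp_all)
        · rcases Nat.add_eq_one_iff.mp h with ⟨h0, h1⟩ | ⟨h0, h1⟩
          · exact hd1 (by ext i; fin_cases i <;> simp [h0, h1])
          · exact hd0 (by ext i; fin_cases i <;> simp [h0, h1])
      have : (PowerSeries.X * f') ^ (d 0) * (PowerSeries.X * g') ^ (d 1) =
          PowerSeries.X ^ (d 0 + d 1) * (f' ^ (d 0) * g' ^ (d 1)) := by ring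
      rw [this, PowerSeries.coeff_X_pow_mul', if_neg (by omega), smul_zero]
  rw [PowerSeries.coeff, MvPowerSeries.coeff_subst hfg,
    finsum_eq_sum_of_support_subset _ (s := {Finsupp.single 0 1, Finsupp.single 1 1}) ?_]
  · rw [Finset.sum_pair (by simp [Finsupp.single_eq_single_iff])]
    simp only [Finsupp.prod_single_index, pow_zero, pow_one, Matrix.cons_val_zero, Matrix.cons_val_one,
      G.lin_coeff_X, G.lin_coeff_Y, one_smul]
  · intro d hd
    simp only [Function.mem_support, ne_eq] at hd
    simp only [Finset.coe_insert, Finset.coe_singleton, Set.mem_insert_iff, Set.mem_singleton_iff]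
    by_cases h0 : d = Finsupp.single 0 1
    · exact Or.inl h0
    by_cases h1 : d = Finsupp.single 1 1
    · exact Or.inr h1
    exact (hd (hterm d h0 h1)).elim

/-- The linear coefficient is additive: `(φ + ψ)₁ = φ₁ + ψ₁`. [cite: Hazewinkel1978, §1.2 (1.2.5)] -/
theorem coeff_one_add [G.IsComm] (φ ψ : FormalGroupHom F G) :
    PowerSeries.coeff 1 (φ.add ψ).toPowerSeries =
      PowerSeries.coeff 1 φ.toPowerSeries + PowerSeries.coeff 1 ψ.toPowerSeries :=
  coeff_one_formalGroup_subst_pair G φ.constantCoeff_eq_zero ψ.constantCoeff_eq_zero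

/-! ## §4 The `[n]`-series -/

variable (F) in
/-- The **`[n]`-series** of a commutative formal group law: the endomorphism `[n]_F` with `[0] = 0`,
`[n+1](T) = F([n](T), T)`. [cite: Hazewinkel1978, §1.2 (1.2.4)] -/
def nsmulHom [F.IsComm] : ℕ → FormalGroupHom F F
  | 0 => FormalGroupHom.zero F F
  | n + 1 => (nsmulHom n).add (FormalGroupHom.id F)

/-- `[0] = 0`. [cite: Hazewinkel1978, §1.2 (1.2.4)] -/
@[simp] theorem nsmulHom_zero [F.IsComm] : nsmulHom F 0 = FormalGroupHom.zero F F := rfl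

/-- `[n+1] = [n] + id`, i.e. `[n+1](T) = F([n](T), T)`. [cite: Hazewinkel1978, §1.2 (1.2.4)] -/
@[simp] theorem nsmulHom_succ [F.IsComm] (n : ℕ) : nsmulHom F (n + 1) = (nsmulHom F n).add (FormalGroupHom.id F) :=
  rfl

/-- `[1] = id` (`F(0, T) = T`). [cite: Hazewinkel1978, §1.2 (1.2.4)] -/
theorem nsmulHom_one [F.IsComm] : nsmulHom F 1 = FormalGroupHom.id F := by
  rw [nsmulHom_succ, nsmulHom_zero, zero_add]

/-- `[m + n] = [m] + [n]`. [cite: Hazewinkel1978, §1.2 (1.2.4)] -/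
theorem nsmulHom_add [F.IsComm] (m n : ℕ) : nsmulHom F (m + n) = (nsmulHom F m).add (nsmulHom F n) := by
  induction n with
  | zero => rw [Nat.add_zero, nsmulHom_zero, add_zero]
  | succ n ih => rw [← Nat.add_assoc, nsmulHom_succ, ih, nsmulHom_succ, add_assoc]

/-- **`[n](T) ≡ n·T (mod deg 2)`**: the linear coefficient of the `[n]`-series is `n`.
[cite: Hazewinkel1978, §1.2 (1.2.4)] -/
theorem coeff_one_nsmulHom [F.IsComm] (n : ℕ) : PowerSeries.coeff 1 (nsmulHom F n).toPowerSeries = n := by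
  induction n with
  | zero => simp
  | succ n ih => rw [nsmulHom_succ, coeff_one_add, ih, id_toPowerSeries, PowerSeries.coeff_one_X, Nat.cast_succ]

end FormalGroupHom

end Literature.RingTheory.FormalGroups
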